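import Summits.Ventures.AbcShadow.SH27.Statement
import Summits.Ventures.AbcShadow.SH27.CurveSide
import Summits.Ventures.AbcShadow.SH27.PowerTrace
import Summits.Ventures.AbcShadow.SH27.NewformSide

/-!
# Venture AbcShadow — SH-27: the [Che10] PRINT INPUTS, LEMMA-SH27-1 and the COMPUTED newform data as NAMED HYPOTHESES

HONEST FRAMING. Interface file of the work-bound cell `abc-shadow` (typer seat `abc-shadow-typ-4`, row SH-27 = `a² + b³⁴ = c⁵`,
the prime `p = 17` excluded in [Che10, Thm 1]). NOTHING in this file is a theorem about a Diophantine equation; nothing here is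
a claim on abc or on any summit; no side on IUT is taken. It TYPES, as named `Prop`s that the row theorem `SH27/RowP17.lean`
takes as explicit hypotheses (named-fact discipline; never `axiom`s, never `instance`s), the inputs of Chen's `ℚ`-curve
modular method EXACTLY in the granularity in which the cell's words use them ("MODULO [Che10] as printed + LEMMA-SH27-1 +
U2"), in the style of `SH01/BVY04Package.lean` ("same architecture, different cited package"):

* `Space`, `QNewformModel` — an ABSTRACT interface for "newforms `g` of weight 2 on `Γ₀(M)` with nebentypus `ψ`",
  `M ∈ {180, 720}`, `ψ` one of the two even order-4 characters of conductor 20 (PARI/Conrey labels `χ₁₈₀(127,·)`,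
  `χ₁₈₀(163,·)`; `χ₇₂₀(127,·)`, `χ₇₂₀(703,·)` — certificate 1f9122f05be32705 block (N) S0), "their Hecke eigenvalues `a_q(g)`
  in a coefficient ring containing `ℤ[i]`" (`eig`, `rootI` = the element `i`, through which `ψ(q) = i^{e(q)}`, `Space.charExp`),
  "`g` has complex multiplication by `ℚ(i)`" (`IsCMi`) and "the mod-17 representation attached to a putative solution ARISES
  from `g`" (`Arises`). Mathlib has no newforms / Galois representations of this kind, so these are UNINTERPRETED; every
  statement is about an arbitrary model `M` and is MEANINGFUL ONLY FOR THE INTENDED MODEL: `Form S` = the newforms of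
  `S₂(Γ₀(M), ψ)`; `Coeff S g = 𝒪_{K_g}`; `eig S g q = a_q(g)`; `rootI S g = i ∈ ℚ(i) ⊆ K_g` (`K_g ⊇ ℚ(ψ) = ℚ(i)`), so that
  `ψ(q) = i^{charExp S q}` with the exponent table of PARI's `χ(127,·)` (`ψ(±3) = i`, `ψ(±9) = −1`, `ψ(±7) = −i` mod 20;
  certificate convention self-check and C-E4) resp. its conjugate; `IsCMi S g` = "`a_q(g)·(−4/q) = a_q(g)` for almost all
  `q`" [Che10, p.369 L58–60]; `Arises D S g` = "`D = (a, b, c; u, v; E)` consists of a non-trivial proper solution of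
  `a² + b³⁴ = c⁵`, its Lemma-2/3 parameters `(u, v)` and the printed choice of Frey curve `E ∈ {E^s, E^t}`, and
  `ρ_{E_β,β,π} ≅ ρ_{g,𝔓} (mod 𝔓)` for a prime `𝔓 ∣ 17`: the mod-17 representation of the abelian variety `A_β` attached to
  the `ℚ`-curve `E_β(u,v)` [Che10 §§3–4] is isomorphic, after extending scalars, to the reduction of the `𝔓`-adic representation
  of `g`". For a degenerate `M` the hypotheses may be false or vacuous; that is the price of an interface, stated once, loudly.
* `Che10Package` — ONE named hypothesis = the PRINTED chain [Che10, Lemma 2 + Lemma 3 (p.346) + Thms 40, 41, 42, Cor 44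
  (pp.366–367) + "It follows from work on the refined Serre conjectures that `ρ_{f,π} ≅ ρ_{g,π}` for a newform
  `g ∈ S₂(Γ₀(M), ε⁻¹)` where `M = 180, 720`" (p.369 L1–3)], read at `p = 17`: a non-trivial proper solution yields coprime
  `(u, v)`, the curve `E` (`E^s` iff `5 ∣ s = v²` [p.365 L9–10]) and a newform `g` in one of the four spaces with `Arises`.
  Print's provisos hold at 17: `p ≠ 2, 3, 5` (Thms 40–42), `p ∉ {2, 3, 5, 7, 13}` (Cor 44, irreducibility). CITED.
* `Che10CMEndgame` — the PRINTED endgame [Che10, proof of Thm 48 (pp.369–370) with Cor 47 (p.368)] at `p = 17`: "`ρ_{f,π} ≅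
  ρ_{g,π}` where `g` has complex multiplication by `ℚ(√−4)`. If `p ≡ 1 (mod 4)`, then `ρ_{f,π} ≅ ρ_{g,π}` would have image
  lying in the normalizer of a split Cartan subgroup, contradicting Corollary 47" (Cor 47: "for `p ≠ 2, 3, 5, 7, 13`").
  `17 ≡ 1 (mod 4)` and `17 ∉ {2,3,5,7,13}`: `Arises D S g → IsCMi S g → False`. CITED.
* `LemmaSH27U` — the cell's ONE UNPRINTED lemma LEMMA-SH27-1 (ENGINE-SPEC-SH27 9d55c9c4a06f0a3d §2.3 U1; "routine"; printed
  anchor [Che10, p.366]: "`ρ|G_{K_β}` is isomorphic to `φ_{E,p}`"; printed biquadratic analogue [BC12, Lemma 24]) together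
  with the PRINTED level-raising condition [Che10, Thm 36 / p.369 L13–15: "`p ∣ N(a_q(g)² − ε⁻¹(q)(q+1)²)` if
  `q ∣ s² − 10st + 5t²`"] in the ideal-wise, residue-class form U2/U3 (method printed in [BC12 §5] / Kraus): `Arises D S g`
  yields a field `k` of characteristic 17 and a ring map `φ : Coeff S g → k` (reduction mod `𝔓`) such that for every prime
  `q ∉ {2, 3, 5, 17}`: if `q ∤ γ(u,v)` then for every prime `𝔮 = (q, h(z))` of `K_β` (`IsKbetaPrime`),
  `p_{f(q)}(φ(a_q(g)), φ(i)^{e(q)}·q) = a_𝔮(E_β(u,v))` in `k`, where `p_f` is the power trace (`SH27/PowerTrace.lean`; the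
  Cayley–Hamilton half of the lemma is PROVED there) and `a_𝔮(E_β(u,v))` is OUR computable point count `curveTrace`
  (`SH27/CurveSide.lean`) of the typed `K_β`-model over `𝔽_q[z]/(h)` at `(u mod q, v mod q)`; if `q ∣ γ(u,v)` then
  `φ(a_q(g))² = φ(i)^{e(q)}(q+1)²`. NOT PRINT; the cell's words carry it as "MODULO LEMMA-SH27-1 + U2".
* `DataComplete` — the COMPUTED hypothesis (certificate 1f9122f05be32705 block (N): PARI/GP 2.17.3 `mfinit` S0/S1, eng-2 kit
  j320427; a_q charpolys = eng-2 certificate 4a36c28685fe0350 215/215, 301/301; independently re-derived by crit-1 g4, kit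
  j320106/j320524, memo crit-1-SH27-K3.md): every newform of the space `S` has `i² = −1` in its coefficient ring and
  matches one of the listed orbit data (`SH27/NewformData.lean`: relative polynomial over `ℤ[i]` and `a_q` at
  `q ∈ {7, 11, 29}`), in characteristic 0 (`Matches`). Not provable here.
* `CMBy` — the COMPUTED + CITED CM certification of the three `K_g = ℚ(i)` orbits of each space (certificate: "`a_m = 0`
  for all `m ≤ 300` with `(−4/m) = −1` (Sturm bound `μ(720)/6 = 288`): CERTIFIED"; identification inputs as in the cell's
  SH-01 ledger: Sturm's bound for `g ⊗ χ₋₄ − g` and twist-stability ⇔ CM): matching a listed CM orbit implies `IsCMi`.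

What is deliberately NOT here: the case `p ≡ 3 (mod 4)` and `p = 13` ([Che10 §6], Cor 47 void); any statement for `p ≠ 17`;
any modular-forms theory; the Tier-2 two-curve corroboration of the certificate. References: [Che10] as above; [BC12]
M. A. Bennett, I. Chen, Algebra Number Theory 6 (2012) 707–730; cell documents ENGINE-SPEC-SH27 9d55c9c4a06f0a3d,
crit-1-SH27.md 3c1a8acc99fe1dce, crit-1-SH27-K3.md 1a88b4065e90d063, certificate-sh27.txt 1f9122f05be32705.
AI-typed; weaker than expert refereeing of the cited inputs.
-/

namespace Summit.Ventures.AbcShadow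
namespace SH27

/-! ## Spaces and the abstract interface -/

/-- The four newform spaces of the sieve: `S₂^new(Γ₀(180), ψ)`, `S₂^new(Γ₀(180), ψ̄)`, `S₂^new(Γ₀(720), ψ)`,
`S₂^new(Γ₀(720), ψ̄)` with `ψ` the even order-4 character of conductor 20 labelled `127` by PARI/Conrey and `ψ̄` its
conjugate (`163` at 180, `703` at 720) [certificate 1f9122f05be32705 S0; Che10 p.369: "`g ∈ S₂(Γ₀(M), ε⁻¹)` where
`M = 180, 720`"]. [cite: Chen2010, p.369 L1–3] -/
inductive Space where
  | s180 | s180c | s720 | s720c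
  deriving DecidableEq, Repr

/-- The level `M ∈ {180, 720}` of a space. [cite: Chen2010, p.369 L1–3] -/
def Space.level : Space → ℕ
  | .s180 => 180
  | .s180c => 180
  | .s720 => 720
  | .s720c => 720

/-- The nebentypus of the space as an exponent of `i`: `ψ(q) = i^{charExp S q}` (`charExp127` / `charExpConj` of
`SH27/NewformSide.lean`: `ψ̄(q) = i^{−e(q)}` for the conjugate spaces). [cite: Chen2010, p.369 L1–11] -/
def Space.charExp : Space → ℕ → ℕ
  | .s180 => charExp127
  | .s720 => charExp127
  | .s180c => charExpConj
  | .s720c => charExpConj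

/-- Data of a putative non-trivial proper solution `(a, b, c)` of `a² + b³⁴ = c⁵` together with its Lemma-2/3 parameters
`(u, v)` (`(u, v) = 1`; `a = u(u⁴ − 10u²v² + 5v⁴)`, `b¹⁷ = v(v⁴ − 10v²u² + 5u⁴)`, `c = u² + v²`; `s = v²`, `t = u²`) and the
printed choice of Frey curve `E ∈ {E^s, E^t}` — what `E_β(u,v)` and `ρ_{E,β,π}` depend on.
[cite: Chen2010, Lemma 2 and Lemma 3 p.346; p.365 L9–10] -/
structure SolDatum where
  /-- the solution -/
  (a b c : ℤ)
  /-- the Lemma-2 parameters -/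
  (u v : ℤ)
  /-- the Frey curve used (`E^s` iff `5 ∣ v`) -/
  E : CurveTag

/-- **Abstract interface for newforms with nebentypus** (module docstring, "MEANINGFUL ONLY FOR THE INTENDED MODEL"):
`Form S` = newforms of the space `S`; `Coeff S g` = a commutative ring containing `ℤ[i]` and the Hecke eigenvalues
(intended `𝒪_{K_g}`); `eig S g q = a_q(g)`; `rootI S g = i` (the nebentypus is `q ↦ i^{charExp S q}`); `IsCMi S g` =
"`g` has CM by `ℚ(i)`"; `Arises D S g` = "the mod-17 representation `ρ_{E_β,β,π}` of the datum `D` (a non-trivial proper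
solution with its parameters and Frey curve) is isomorphic mod a prime `𝔓 ∣ 17` to that of `g`" [Che10 §§3–5]. The analogue,
for Chen's `ℚ`-curve setting, of `Summit.Ventures.AbcSig.NewformModel`. No instance is declared (the coefficient ring is
bundled as a `CommRingCat`). [cite: Chen2010, pp.365–369 (vocabulary)] -/
structure QNewformModel where
  /-- newforms of the space `S` -/
  Form : Space → Type
  /-- coefficient ring of `g` (bundled commutative ring) -/
  Coeff : (S : Space) → Form S → CommRingCat.{0}
  /-- Hecke eigenvalue `a_q(g)` at the prime `q` (values at non-primes never used) -/
  eig : (S : Space) → (g : Form S) → ℕ → Coeff S g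
  /-- the element `i` of the coefficient ring carrying the nebentypus -/
  rootI : (S : Space) → (g : Form S) → Coeff S g
  /-- "`g` has complex multiplication by `ℚ(i)`" -/
  IsCMi : (S : Space) → Form S → Prop
  /-- "the mod-17 representation of the datum arises from `g`" -/
  Arises : SolDatum → (S : Space) → Form S → Prop

/-- `M.Matches g o` (characteristic 0): the newform `g` carries the certified orbit data `o` — some `θ ∈ Coeff g` has
`P(i, θ) = 0` and `d_q · a_q(g) = g_q(i, θ)` for every listed entry (every `Gal(ℚ̄/ℚ(i))`-conjugate of the engine's
representative matches the same `o`). The analogue of `AbcSig.NewformModel.Matches`. [folklore] -/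
def QNewformModel.Matches (M : QNewformModel) {S : Space} (g : M.Form S) (o : Orbit27) : Prop :=
  ∃ θ : M.Coeff S g, evalQi (M.rootI S g) θ o.P = 0 ∧
    ∀ en ∈ o.entries, (en.d : M.Coeff S g) * M.eig S g en.q = evalQi (M.rootI S g) θ en.g

/-! ## The named hypotheses -/

/-- **NAMED HYPOTHESIS [Che10, Lemma 2/3 + Thms 40–42 + Cor 44 + p.369 L1–3] — the `ℚ`-curve modular-method package at
`p = 17`.** Printed inputs. Lemma 2 (p.346): "A triple `(x, y, z) ∈ ℤ³` with `(x, y, z) = 1` satisfies `x² + y² = z⁵` only if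
`(x, y, z) = (u(u⁴ − 10u²v² + 5v⁴), v(v⁴ − 10v²u² + 5u⁴), u² + v²)` for some `(u, v) ∈ ℤ²` with `(u, v) = 1`"; Lemma 3:
`s = v²`, `t = u²`, `s² − 10st + 5t² = 5ʲγᵖ`; p.365 L9–10: "we choose `E` to be `E^s` if `s ≡ 0 (mod 5)` and `E^t` if
`s ≢ 0 (mod 5)`"; Thm 40: "Suppose `p ≠ 2, 3`. The conductor of `ρ = ρ_{E,β,π} ≅ ρ_{f,π}` is one of 180, 720"; Thm 41 (weight
2, `p ≠ 2,3,5`); Thm 42 (character `ε⁻¹`); Cor 44: "The representation `ρ_{E,β,π}` is irreducible for `p ≠ 2, 3, 5, 7, 13`";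
p.369 L1–3: "It follows from work on the refined Serre conjectures that `ρ_{f,π} ≅ ρ_{g,π}` for a newform
`g ∈ S₂(Γ₀(M), ε⁻¹)` where `M = 180, 720`." At `p = 17` all provisos hold. In the interface: a non-trivial proper solution
of `a² + b³⁴ = c⁵` has coprime Lemma-2 parameters `(u, v)`, the curve `E` (`E^s` iff `5 ∣ v`), and a newform `g` in one of
the four spaces (both conjugate characters admitted — no convention on `ε(±3) = i` is relied on) with `M.Arises`. CITED,
never proved here; the row takes `(hP : Che10Package M)`. [cite: Chen2010, Lemma 2-3 p.346, Thms 40-42 and Cor 44 pp.366-367, p.369 L1-3] -/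
def Che10Package (M : QNewformModel) : Prop :=
  ∀ a b c : ℤ, a ^ 2 + b ^ 34 = c ^ 5 → SH27.IsProper a b c → a * b ≠ 0 →
    ∃ (u v : ℤ) (E : CurveTag) (S : Space) (g : M.Form S),
      IsCoprime u v ∧ (E = CurveTag.s ↔ (5 : ℤ) ∣ v) ∧ M.Arises ⟨a, b, c, u, v, E⟩ S g

/-- **NAMED HYPOTHESIS [Che10, proof of Thm 48 + Cor 47] — the CM endgame at `p = 17`.** Printed: Cor 47 (p.368): "The
image of the representation `ρ_{E,β,π}` does not lie in the normalizer of a split Cartan subgroup for `p ≠ 2, 3, 5, 7, 13`"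
(proof: a non-trivial proper solution gives multiplicative reduction above a prime `∉ {2,3,5}` by Cor 8); proof of Thm 48
(pp.369–370): "we must have `ρ_{f,π} ≅ ρ_{g,π}`, where `g` has complex multiplication by `ℚ(√−4)`. If `p ≡ 1 (mod 4)`,
then `ρ_{f,π} ≅ ρ_{g,π}` would have image lying in the normalizer of a split Cartan subgroup, contradicting Corollary 47"
(details p.370: `A_g ~ C²` with `C ∈ {E₀, E₁}`, `p` split in `F·K_g`, [28, Prop 4.4], `L` has no primitive `p`-th root of
unity for `p > 5`). Read at `p = 17` (`17 ≡ 1 (mod 4)`, `17 ∉ {2,3,5,7,13}`): arising from a CM-by-`ℚ(i)` newform is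
contradictory. CITED, never proved here. [cite: Chen2010, Cor 47 p.368 and proof of Thm 48 pp.369-370] -/
def Che10CMEndgame (M : QNewformModel) : Prop :=
  ∀ (D : SolDatum) (S : Space) (g : M.Form S), M.Arises D S g → M.IsCMi S g → False

/-- **NAMED HYPOTHESIS — LEMMA-SH27-1 + U2 (UNPRINTED, the cell's one new lemma) with [Che10, Thm 36] (PRINTED).**
Statement (ENGINE-SPEC-SH27 9d55c9c4a06f0a3d §2.3 U1): let `ρ̄_{f,π} ≅ ρ̄_{g,𝔓}` (`Arises`), `q ∤ 2·3·5·17` prime, `𝔮 ∣ q`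
a prime of `K_β = ℚ(z)` of residue degree `f(q) ∈ {1, 2, 4}`, `τ = a_q(g) mod 𝔓`, `d = ψ(q)·q mod 𝔓`. (a) If
`q ∤ γ(u,v)`: `E_β(u,v)` has good reduction at `𝔮` and with `A = a_𝔮(E_β(u,v)) = q^f + 1 − #Ē_β(𝔽_𝔮) ∈ ℤ`:
`p_f(τ, d) = A` in `𝒪_{K_g}/𝔓` (`p₁ = τ`, `p₂ = τ² − 2d`, `p₄ = τ⁴ − 4dτ² + 2d²`). Proof sketch: `tr ρ̂(Frob_q) = a_q(f)`,
`det ρ̂(Frob_q) = ε⁻¹(q)q` [Che10 (1)]; `Frob_q^f ∈ G_{K_β}` on which `ρ̂ ≅ φ̂_{E_β,p}` [Che10 p.366: "`ρ|G_{K_β}` is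
isomorphic to `φ_{E,p}`"], so `tr ρ̂(Frob_q^f) = a_𝔮(E_β)`; Cayley–Hamilton (`SH27/PowerTrace.lean`, PROVED); reduce mod `π`
and transport along `ρ̄_{f,π} ≅ ρ̄_{g,𝔓}`. Printed analogue for `f ≤ 2` over a biquadratic field: [BC12, Lemma 24]. (b) If
`q ∣ γ(u,v)` (multiplicative reduction): `τ² = ψ(q)(q+1)²` [Che10, Thm 36; p.369: "`p ∣ N(a_q(g)² − ε⁻¹(q)(q+1)²)` if
`q ∣ s² − 10st + 5t²`"]. U2 (residue-class refinement, method printed in [BC12 §5]/Kraus): the identity is used at the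
actual class `(u, v) mod q`. In the interface: ONE ring map `φ : Coeff S g → k` into a field of characteristic 17 (the
reduction mod `𝔓`, same for all `q`), `ψ(q) = φ(i)^{charExp S q}`, `f = fdeg q`, primes `𝔮 = (q, h)` via `IsKbetaPrime`, and
`A` = OUR computable `curveTrace E q h (u mod q) (v mod q)` (`SH27/CurveSide.lean`). NOT PRINT; never proved here; the row
takes `(hL : LemmaSH27U M)` and the cell's words say "MODULO LEMMA-SH27-1 + U2".
[cite: Chen2010, p.366 L117 («ρ|G_{K_β} ≅ φ_{E,p}», the anchor) and Thm 36 p.365, p.369 L13-15; BennettChen2012 Lemma 24 (printed analogue)] -/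
def LemmaSH27U (M : QNewformModel) : Prop :=
  ∀ (D : SolDatum) (S : Space) (g : M.Form S), M.Arises D S g →
    ∃ (k : Type) (_ : Field k) (_ : CharP k 17) (φ : M.Coeff S g →+* k),
      ∀ (q : ℕ) [NeZero q], q.Prime → q ≠ 2 → q ≠ 3 → q ≠ 5 → q ≠ 17 →
        (¬ (q : ℤ) ∣ gammaUV D.u D.v → ∀ h : List ℤ, IsKbetaPrime q h →
            powerTrace (φ (M.eig S g q)) (φ (M.rootI S g) ^ S.charExp q * q) (fdeg q) =
              (curveTrace D.E q h (D.u : ZMod q) (D.v : ZMod q) : k)) ∧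
        ((q : ℤ) ∣ gammaUV D.u D.v →
            φ (M.eig S g q) ^ 2 = φ (M.rootI S g) ^ S.charExp q * ((q : k) + 1) ^ 2)

/-- **COMPUTED HYPOTHESIS** `M.DataComplete S orbits`: in the space `S`, `i² = −1` in every coefficient ring and every newform
matches (in characteristic 0) one of the listed orbit data. Certificate 1f9122f05be32705 block (N) (S0 census: `[1,1,1,4,6]` at
180, `[1,1,1,2,2,4,4]` at 720 = print [Che10 p.369 L27–38] = eng-2; S1; `a_q`); re-derived independently by the critic
(crit-1-SH27-K3.md §2(a), (e)). Not provable in this interface. [cite: Chen2010, p.369 L27–38 (the printed census the data reproduce; the data are COMPUTED)] -/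
def QNewformModel.DataComplete (M : QNewformModel) (S : Space) (orbits : List Orbit27) : Prop :=
  ∀ g : M.Form S, M.rootI S g ^ 2 = -1 ∧ ∃ o ∈ orbits, M.Matches g o

/-- **COMPUTED / CITED HYPOTHESIS** `M.CMBy S cm`: every newform of `S` matching one of the listed `K_g = ℚ(i)` orbit data has
complex multiplication by `ℚ(i)` (certificate 1f9122f05be32705: "`a_m = 0` for all `m ≤ 300` with `(−4/m) = −1` (Sturm bound
`μ(720)/6 = 288`): CERTIFIED" for each of the `3 + 3 + 3 + 3` orbits; identification by Sturm's bound applied to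
`g ⊗ χ₋₄ − g` and twist-stability ⇔ CM; print: "three newforms `g` such that `K_g = ℚ(i)` and these all have complex
multiplication by `ℚ(√−4)`" at each level). Not provable in this interface. [cite: Chen2010, p.369 L29–31 and L35–38] -/
def QNewformModel.CMBy (M : QNewformModel) (S : Space) (cm : List Orbit27) : Prop :=
  ∀ g : M.Form S, ∀ o ∈ cm, M.Matches g o → M.IsCMi S g

end SH27
end Summit.Ventures.AbcShadow
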